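import Summits.QuantumFields.BalabanUV.T4Continuum.Support.NE7K1LinBlochDenominator
import Literature.MathematicalPhysics.QuantumFieldTheory.Balaban1983to89.B5Strip145Decay

/-!
# NE7K1LinBlochSymbol — row NE7 (node U5), candidate route HOM, path H1L, cell K1-lin(s): NEEDS-ESTIMATE #E1, B-E1 TYPED —
# THE STRIP CLAUSES OF THE CONTINUUM BLOCK-MEAN MULTIPLIER `k_L = Δ^ξ_L ∕ 𝓝_L`: holomorphy and a modulus bound on the strip of
# THEOREM S (file 47), the `2π` LAW across the strip sides, and the packaging `B4ContourShift.StripRegular (kL L) κ_N(D) B_K(D)`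
# FOR EVERY `L ≥ 1` — the tree's own consumer interface of the contour-shift engine; the K1-lin(s) LINE's multiplier
# `(1−s)·Δ¹ + s·k_L` is strip-regular with `s`-free constants

Lineage `b2b-balaban-t4-ne7-p2` (CRUX PROVER NE7 #2), generation 74; file 48.  File 47 typed THEOREM S (lens 2's S-64-1; desk
PRICING-NE7 v32 §233 (f) «B-E1 := TYPING ONLY»): `c_N(d) ≤ ‖𝓝_L(p)‖` on `B4Strip.Strip d κ_N(d)` for every `L ≥ 1`.  THIS FILE
derives the clauses the strip engine consumes of the multiplier `k_L = Δ^ξ_L ∕ 𝓝_L` (S-64-1 §3 (c′)(e′); lens 2 g67 N-67-1: «the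
engine reaches the torus by Poisson descent of the CONTINUUM multiplier»):

* §1 on the strip of half-width `κ_N(d)`: JOINT HOLOMORPHY `differentiableAt_kL` (`dAt_div`), continuity, the MODULUS BOUND
  `norm_kL_le : ‖k_L(p)‖ ≤ ‖Δ^ξ_L(p)‖ ∕ c_N(d)`, its quadratic form `norm_kL_le_quad : ‖k_L(p)‖ ≤ c_N(d)⁻¹ Σ_μ((Re p_μ)² + (25∕16)(Im p_μ)²)`
  (the vanishing at `p = 0` KEPT — `B4StripCauchy.norm_Sxi_le`) and `norm_kL_le_const : ‖k_L(p)‖ ≤ 16d ∕ c_N(d)`.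
* §2 THE `2π` LAW: the shift law `Nsym_tr : 𝓝_L(p + 2πe_μ)·Δ^ξ_L(p) = Δ^ξ_L(p + 2πe_μ)·𝓝_L(p)` (from `B5Strip145Analytic.E_tr` —
  `𝓝_L` itself is only quasi-periodic), hence `kL_tr : k_L(p + 2πe_μ) = k_L(p)` whenever `p_μ ∉ {0, −2π}` and `Δ^ξ_L` is nonzero at
  both points, and **`kL_periodic_side`**: on the strip (`κ ≤ 1`, `dκ² ≤ 1∕16`) with `Re p_μ = −π` the four side conditions hold
  (`re_DeltaXi_pos_of_edge`) — the identification of the two vertical sides a contour shift in the coordinate `μ` uses.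
* §3 **`kL_stripRegular : StripRegular (kL L) κ_N(D) (16D ∕ c_N(D))`** for EVERY `L ≥ 1` (`D = d+1` coordinates, the engine's
  convention) — continuity, slice holomorphy through real base points, side matching, bound; hence BY NAME
  `latticeKernel_kL_decay : ‖(2π)^{−D}∫_{[−π,π]^D} k_L(p)e^{ip·x}dp‖ ≤ (16D∕c_N(D))·e^{−κ_N(D)|x|_∞}` (`B4ContourShift.latticeKernel_decay`:
  the unit-lattice Fourier coefficients of the block-mean multiplier — the infinite-volume block-mean Schur complement's row, by
  lens 2's CLAIM (I), which is NOT typed here — decay exponentially, `L`-uniformly), and the torus descent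
  `B4TorusKernel.MultiPeriod.torusKernel_descend_eq ∕ _decay` applies to `kL L` as it stands.
* §4 THE K1-lin(s) LINE: `Delta1_stripRegular` (the unit-lattice Laplacian symbol `Δ¹ = Σ_μ S₁(p_μ)`: entire, `2π`-periodic,
  `‖Δ¹‖ ≤ 16D` on the strip) and **`line_stripRegular`**: for every `s ∈ [0,1]` the line's multiplier `p ↦ (1−s)·Δ¹(p) + s·k_L(p)` is
  strip-regular on `Strip D κ_N(D)` with the `s`-FREE bound `16D ∕ c_N(D)`.

HONEST FRAMING: [folklore]; every estimate is the tree's BY NAME (`B4Strip`, `B4StripCauchy`, `B5Strip145Analytic`, `B5Strip145Decay`,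
`B4ContourShift`); existence-grade constants; the WINDOW on the real zone, the off-axis real-part floor (a′)(b′) and the derivative
bounds (e′) are NOT in this file; the identification of files 36–37's finite-torus symbol with the samples of `k_L` (per-fibre KKT)
is NOT typed; R-E1 untouched; nothing of Bałaban's asserted; no `sorry`.  Census only (B-E1's strip clauses for the continuum
multiplier); NE7 NOT PRINTED ∕ NOT PROVED; spine 0∕9; FIXED FINITE T⁴, rung (B)+1; NOT infinite volume, NOT mass gap, NOT Clay.
HONEST DEPENDENCY: continuum YM on T⁴ ⇐ BetaPertH ∧ nine spine estimates (0/9 proved); BetaPertH ⇐ (D1) ∧ (D4) ∧ CAP+tail; G-an2-4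
gates asym, D1 and NE2/3/4.
-/

noncomputable section

open Finset Complex Set

namespace Summit.QuantumFields.BalabanUV.T4Continuum.NE7K1LinBlochSymbol

open Literature.MathematicalPhysics.QuantumFieldTheory.Balaban1983to89
open Literature.MathematicalPhysics.QuantumFieldTheory.Balaban1983to89.B4Strip
open Literature.MathematicalPhysics.QuantumFieldTheory.Balaban1983to89.B4StripCauchy
open Literature.MathematicalPhysics.QuantumFieldTheory.Balaban1983to89.B5Strip145Analytic
open Literature.MathematicalPhysics.QuantumFieldTheory.Balaban1983to89.B5Strip145Decay
open Literature.MathematicalPhysics.QuantumFieldTheory.Balaban1983to89.B4ContourShift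
open NE7K1LinBlochDenominator
open scoped Real

variable {d : ℕ}

/-! ### §1 Holomorphy, continuity and the modulus bound of `k_L` on the strip -/

/-- `k_L = Δ^ξ_L ∕ 𝓝_L` is holomorphic (jointly in `p ∈ ℂ^d`) at every point of the strip of half-width `κ ≤ κ_N(d)` (quotient of
holomorphic functions, denominator `≠ 0` by THEOREM S), for every `L ≥ 1`. [folklore] -/
theorem differentiableAt_kL (L : ℕ) [NeZero L] {κ : ℝ} (hκ : κ ≤ kappaN d) {p : Fin d → ℂ} (hp : p ∈ Strip d κ) :
    DifferentiableAt ℂ (kL L) p := by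
  have hp' : p ∈ Strip d (kappaN d) := strip_mono hκ hp
  show DifferentiableAt ℂ (fun q => kL L q) p
  simp only [kL]
  exact dAt_div (differentiableAt_DeltaXi L 0 p)
    (differentiableAt_Nsym L (rOf_le d) (d_mul_rOf_sq_le d) (strip_kappaN_subset_fat hp')) (Nsym_ne_zero L hp')

/-- `k_L` is continuous on the strip. [folklore] -/
theorem continuousOn_kL (L : ℕ) [NeZero L] {κ : ℝ} (hκ : κ ≤ kappaN d) : ContinuousOn (kL L) (Strip d κ) :=
  fun _ hp => (differentiableAt_kL L hκ hp).continuousAt.continuousWithinAt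

/-- MODULUS BOUND (clause (c′)): `‖k_L(p)‖ ≤ ‖Δ^ξ_L(p)‖ ∕ c_N(d)` on the strip of half-width `κ_N(d)`. [folklore] -/
theorem norm_kL_le (L : ℕ) [NeZero L] {p : Fin d → ℂ} (hp : p ∈ Strip d (kappaN d)) :
    ‖kL L p‖ ≤ ‖DeltaXi L 0 p‖ / cN d := by
  unfold kL
  rw [norm_div]
  exact div_le_div_of_nonneg_left (norm_nonneg _) (cN_pos d) (Nsym_strip_lower L p hp)

/-- the quadratic bound of `Δ^ξ_L` on the strip: `‖Δ^ξ_L(p)‖ ≤ Σ_μ ((Re p_μ)² + (25∕16)(Im p_μ)²)` (`B4StripCauchy.norm_Sxi_le`,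
`|Im p_μ| ≤ 1`). [folklore] -/
theorem norm_DeltaXi_zero_le_quad (L : ℕ) [NeZero L] {κ : ℝ} (hκ1 : κ ≤ 1) {p : Fin d → ℂ} (hp : p ∈ Strip d κ) :
    ‖DeltaXi L 0 p‖ ≤ ∑ μ, ((p μ).re ^ 2 + 25 / 16 * (p μ).im ^ 2) := by
  have hL : 1 ≤ L := Nat.one_le_iff_ne_zero.mpr (NeZero.ne L)
  unfold DeltaXi
  push_cast
  rw [add_zero]
  exact (norm_sum_le _ _).trans (Finset.sum_le_sum (fun μ _ => norm_Sxi_le L hL (p μ) ((hp μ).2.trans hκ1)))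

/-- MODULUS BOUND WITH THE QUADRATIC VANISHING KEPT (clause (c′), S-64-1 §3): on the strip of half-width `κ_N(d)`,
`‖k_L(p)‖ ≤ c_N(d)⁻¹ · Σ_μ ((Re p_μ)² + (25∕16)(Im p_μ)²)` — b04's own `|S_ξ|` shape with `1 ↦ c_N(d)⁻¹`. [folklore] -/
theorem norm_kL_le_quad (L : ℕ) [NeZero L] {p : Fin d → ℂ} (hp : p ∈ Strip d (kappaN d)) :
    ‖kL L p‖ ≤ (∑ μ, ((p μ).re ^ 2 + 25 / 16 * (p μ).im ^ 2)) / cN d :=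
  (norm_kL_le L hp).trans
    (div_le_div_of_nonneg_right (norm_DeltaXi_zero_le_quad L (kappaN_small d).1 hp) (cN_pos d).le)

/-- UNIFORM BOUND (clause (c′)): `‖k_L(p)‖ ≤ 16d ∕ c_N(d)` on the strip of half-width `κ_N(d)`, every `L ≥ 1`
(`B4StripCauchy.norm_DeltaXi_le` on the fat region). [folklore] -/
theorem norm_kL_le_const (L : ℕ) [NeZero L] {p : Fin d → ℂ} (hp : p ∈ Strip d (kappaN d)) :
    ‖kL L p‖ ≤ 16 * d / cN d := by
  have hL : 1 ≤ L := Nat.one_le_iff_ne_zero.mpr (NeZero.ne L)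
  refine (norm_kL_le L hp).trans (div_le_div_of_nonneg_right ?_ (cN_pos d).le)
  have := norm_DeltaXi_le L hL 0 le_rfl (rOf_le d) (strip_kappaN_subset_fat hp)
  linarith

/-! ### §2 The `2π` law -/

/-- THE SHIFT LAW OF `𝓝_L`: `𝓝_L(p + 2π e_μ) · Δ^ξ_L(p) = Δ^ξ_L(p + 2π e_μ) · 𝓝_L(p)` whenever `p_μ ∉ {0, −2π}` and both `Δ^ξ_L` are
nonzero (`B5Strip145Analytic.E_tr` at `(a, m²) = (1, 0)` and `E = Δ^ξ + 𝓝`; `𝓝_L` itself is only quasi-periodic). [folklore] -/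
theorem Nsym_tr (L : ℕ) [NeZero L] (p : Fin d → ℂ) (μ : Fin d) (hz : p μ ≠ 0) (hz' : p μ + 2 * Real.pi ≠ 0)
    (h0 : DeltaXi L 0 p ≠ 0) (h1 : DeltaXi L 0 (tr p μ) ≠ 0) :
    Nsym L (tr p μ) * DeltaXi L 0 p = DeltaXi L 0 (tr p μ) * Nsym L p := by
  have hE := E_tr L 1 0 p μ hz hz' h0 h1
  rw [E_one_zero_eq, E_one_zero_eq] at hE
  linear_combination hE

/-- **THE `2π` LAW**: `k_L(p + 2π e_μ) = k_L(p)` whenever `p_μ ∉ {0, −2π}` and `Δ^ξ_L(p)`, `Δ^ξ_L(p + 2πe_μ)` are nonzero — as it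
must be for a unit-lattice Fourier multiplier (alias re-indexing `k ↦ k + e_μ`). [folklore] -/
theorem kL_tr (L : ℕ) [NeZero L] (p : Fin d → ℂ) (μ : Fin d) (hz : p μ ≠ 0) (hz' : p μ + 2 * Real.pi ≠ 0)
    (h0 : DeltaXi L 0 p ≠ 0) (h1 : DeltaXi L 0 (tr p μ) ≠ 0) : kL L (tr p μ) = kL L p := by
  have key := Nsym_tr L p μ hz hz' h0 h1
  unfold kL
  by_cases hN : Nsym L p = 0
  · have hNt : Nsym L (tr p μ) = 0 := by
      rw [hN, mul_zero] at key
      exact (mul_eq_zero.mp key).resolve_right h0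
    rw [hN, hNt, div_zero, div_zero]
  by_cases hNt : Nsym L (tr p μ) = 0
  · rw [hNt, zero_mul] at key
    exact absurd ((mul_eq_zero.mp key.symm).resolve_left h1) hN
  rw [div_eq_div_iff hNt hN]
  linear_combination (-1 : ℂ) * key

/-- **PERIODICITY ACROSS THE STRIP SIDES.**  For `p` in the strip `|Re p_ν| ≤ π`, `|Im p_ν| ≤ κ` (`κ ≤ 1`, `dκ² ≤ 1∕16`) with
`Re p_μ = −π`:  `k_L(p + 2π e_μ) = k_L(p)` — all four side conditions of `kL_tr` hold there (`B5Strip145Analytic.re_DeltaXi_pos_of_edge`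
at both points). [folklore] -/
theorem kL_periodic_side (L : ℕ) [NeZero L] {κ : ℝ} (hκ1 : κ ≤ 1) (hdκ : (d : ℝ) * κ ^ 2 ≤ 1 / 16)
    {p : Fin d → ℂ} (hp : p ∈ Strip d κ) (μ : Fin d) (hre : (p μ).re = -Real.pi) : kL L (tr p μ) = kL L p := by
  have hπ := Real.pi_pos
  have hz : p μ ≠ 0 := by
    intro h; rw [h, Complex.zero_re] at hre; linarith
  have hz' : p μ + 2 * Real.pi ≠ 0 := by
    intro h
    have := congrArg Complex.re h
    rw [← tr_apply_self, tr_re_self, hre, Complex.zero_re] at this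
    linarith
  have h0 : DeltaXi L 0 p ≠ 0 := by
    intro h
    have := re_DeltaXi_pos_of_edge L 0 le_rfl hκ1 hdκ (fun ν => (hp ν).2) μ
      (by rw [hre, abs_neg, abs_of_pos hπ])
    rw [h, Complex.zero_re] at this
    linarith
  have h1 : DeltaXi L 0 (tr p μ) ≠ 0 := by
    intro h
    have := re_DeltaXi_pos_of_edge L 0 le_rfl hκ1 hdκ (q := tr p μ)
      (fun ν => by rw [tr_im]; exact (hp ν).2) μ (by rw [tr_re_self, hre]; ring_nf; exact abs_of_pos hπ)
    rw [h, Complex.zero_re] at this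
    linarith
  exact kL_tr L p μ hz hz' h0 h1

/-! ### §3 `k_L` is strip-regular (the contour-shift engine's interface), for every `L` -/

/-- **`k_L` IS STRIP-REGULAR** in the sense of `B4ContourShift.StripRegular`, on the strip of half-width `κ_N(D)` with the bound
`16D ∕ c_N(D)`, for EVERY blocking factor `L ≥ 1` (`D = d+1` coordinates): continuous on the closed strip, holomorphic in every
coordinate slice through a real base point, matching on the two vertical sides, bounded.  Constants depend on `D` alone. [folklore] -/
theorem kL_stripRegular (L : ℕ) [NeZero L] :
    StripRegular (d := d) (kL L) (kappaN (d + 1)) (16 * (d + 1 : ℕ) / cN (d + 1)) := by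
  have hκ0 : 0 ≤ kappaN (d + 1) := (kappaN_pos _).le
  obtain ⟨hκ1, hdκ⟩ := kappaN_small (d + 1)
  refine ⟨continuousOn_kL L le_rfl, ?_, ?_, fun p hp => norm_kL_le_const L hp⟩
  · intro i q hq z hz
    have hP : i.insertNth z (ofRealVec q) ∈ Strip (d + 1) (kappaN (d + 1)) :=
      insertNth_mem_Strip hκ0 i hq (openRect_subset_closedRect _ hz)
    exact ((differentiableAt_kL L le_rfl hP).comp z (differentiableAt_insertNth i _ z)).differentiableWithinAt
  · intro i q hq y hy
    obtain ⟨hP, hre⟩ := insertNth_left_mem hκ0 i hq hy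
    rw [← tr_insertNth_left]
    exact (kL_periodic_side L hκ1 hdκ hP i hre).symm

/-- HENCE, BY NAME (`B4ContourShift.latticeKernel_decay`): the unit-lattice Fourier coefficients of the block-mean multiplier decay
exponentially, `‖(2π)^{−D} ∫_{[−π,π]^D} k_L(p) e^{ip·x} dp‖ ≤ (16D ∕ c_N(D)) · e^{−κ_N(D)|x|_∞}`, for every `L ≥ 1` and `x ∈ ℤ^D`. [folklore] -/
theorem latticeKernel_kL_decay (L : ℕ) [NeZero L] (x : Fin (d + 1) → ℤ) :
    ‖latticeKernel (kL L) x‖ ≤ 16 * (d + 1 : ℕ) / cN (d + 1) * Real.exp (-(kappaN (d + 1) * supNorm x)) :=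
  latticeKernel_decay (kL_stripRegular L) (kappaN_pos _).le x

/-! ### §4 The K1-lin(s) line's multiplier `(1−s)·Δ¹ + s·k_L` -/

/-- the unit-lattice Laplacian symbol `Δ¹ = Σ_μ S₁(p_μ)` is `2π`-periodic in every coordinate. [folklore] -/
theorem Delta1_tr (m2 : ℝ) (p : Fin d → ℂ) (μ : Fin d) : Delta1 m2 (tr p μ) = Delta1 m2 p := by
  unfold Delta1
  congr 1
  refine Finset.sum_congr rfl (fun ν _ => ?_)
  by_cases h : ν = μ
  · subst h; rw [tr_apply_self, S1_add_two_pi]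
  · rw [tr_apply_of_ne h]

/-- `Δ¹` is entire (jointly). [folklore] -/
theorem differentiableAt_Delta1 (m2 : ℝ) (q : Fin d → ℂ) : DifferentiableAt ℂ (fun p : Fin d → ℂ => Delta1 m2 p) q := by
  simp only [Delta1]
  apply DifferentiableAt.add_const
  apply DifferentiableAt.fun_sum
  intro ν _
  exact (differentiable_S1 _).comp q (differentiableAt_apply ν q)

/-- `‖Δ¹(p)‖ ≤ 16d` on every strip of half-width `κ ≤ 1∕4` (`B4StripCauchy.norm_S1_le_16`). [folklore] -/
theorem norm_Delta1_le {κ : ℝ} (hκ : κ ≤ 1 / 4) (hκ0 : 0 ≤ κ) {p : Fin d → ℂ} (hp : p ∈ Strip d κ) :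
    ‖Delta1 0 p‖ ≤ 16 * d := by
  unfold Delta1
  push_cast
  rw [add_zero]
  calc ‖∑ μ, S1 (p μ)‖ ≤ ∑ μ, ‖S1 (p μ)‖ := norm_sum_le _ _
    _ ≤ ∑ _μ : Fin d, (16 : ℝ) := Finset.sum_le_sum (fun μ _ =>
        norm_S1_le_16 hκ (by linarith [(hp μ).1]) (by linarith [(hp μ).2]))
    _ = 16 * d := by simp [mul_comm]

/-- `Δ¹` is strip-regular on the strip of half-width `κ_N(D)` with bound `16D`. [folklore] -/
theorem Delta1_stripRegular : StripRegular (d := d) (Delta1 0) (kappaN (d + 1)) (16 * (d + 1 : ℕ)) := by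
  have hκ0 : 0 ≤ kappaN (d + 1) := (kappaN_pos _).le
  have hκ4 : kappaN (d + 1) ≤ 1 / 4 := (kappaN_le_rOf _).trans (rOf_le _)
  refine ⟨fun p _ => (differentiableAt_Delta1 0 p).continuousAt.continuousWithinAt, ?_, ?_, fun p hp => norm_Delta1_le hκ4 hκ0 hp⟩
  · intro i q _ z _
    exact ((differentiableAt_Delta1 0 _).comp z (differentiableAt_insertNth i _ z)).differentiableWithinAt
  · intro i q _ y _
    rw [← tr_insertNth_left, Delta1_tr]

/-- **THE K1-lin(s) LINE'S MULTIPLIER IS STRIP-REGULAR, UNIFORMLY IN `s ∈ [0,1]` AND `L ≥ 1`**: `p ↦ (1−s)·Δ¹(p) + s·k_L(p)` (unit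
coarse spacing; the symbol `σ_s` of the two-cutoff line `(1−s)(−Δ) + s·K_L`, lens 2's CLAIM (I) normalisation) is strip-regular on
`Strip D κ_N(D)` with the `s`-FREE bound `16D ∕ c_N(D)` (closure `StripRegular.add ∕ .mul ∕ stripRegular_const` and `c_N ≤ 1∕2`). [folklore] -/
theorem line_stripRegular (L : ℕ) [NeZero L] {s : ℝ} (hs0 : 0 ≤ s) (hs1 : s ≤ 1) :
    StripRegular (d := d) (fun p => (1 - s : ℂ) * Delta1 0 p + (s : ℂ) * kL L p) (kappaN (d + 1))
      (16 * (d + 1 : ℕ) / cN (d + 1)) := by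
  have h1 := (stripRegular_const (d := d) (1 - (s : ℂ)) (kappaN (d + 1))).mul Delta1_stripRegular (norm_nonneg _)
  have h2 := (stripRegular_const (d := d) (s : ℂ) (kappaN (d + 1))).mul (kL_stripRegular L) (norm_nonneg _)
  have h := h1.add h2
  refine h.mono ?_
  have hc := cN_pos (d + 1)
  have hc2 := cN_le_half (d + 1)
  have e1 : ‖(1 : ℂ) - (s : ℂ)‖ = 1 - s := by
    rw [show (1 : ℂ) - (s : ℂ) = ((1 - s : ℝ) : ℂ) by push_cast; ring, Complex.norm_real, Real.norm_eq_abs,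
      abs_of_nonneg (by linarith)]
  have e2 : ‖(s : ℂ)‖ = s := by rw [Complex.norm_real, Real.norm_eq_abs, abs_of_nonneg hs0]
  rw [e1, e2]
  have hD : (0 : ℝ) ≤ 16 * ((d + 1 : ℕ) : ℝ) := by positivity
  have hle : 16 * ((d + 1 : ℕ) : ℝ) ≤ 16 * ((d + 1 : ℕ) : ℝ) / cN (d + 1) := by
    rw [le_div_iff₀ hc]; nlinarith
  nlinarith [mul_le_mul_of_nonneg_left hle (by linarith : (0:ℝ) ≤ 1 - s)]

end Summit.QuantumFields.BalabanUV.T4Continuum.NE7K1LinBlochSymbol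

end
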